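import Summits.QuantumFields.BalabanUV.Beta.GAN24.PerfectStepBloch
import Summits.QuantumFields.BalabanUV.Beta.FP.PerfectRebase

/-!
# `BalabanUV.Beta.FP.PerfectSymbolKBloch` — road «FP» for binder row D1, leaf N0b-K («symbol of `KPerf`»): **EVERY `m`, ALL FOUR QUARTERS, REDUCED TO X1m-K**
# — the perfect `m`-fold resolvent `KPerf Lc (sfStep Lc) (smStep 3 Lc) m`, whenever the (j, m)-family converges (X1m-K), and UNCONDITIONALLY along the arithmetic
# subsequence `j ∈ mℕ`, IS the Bloch kernel of gan24-p3's re-based limit fibre function `GAN24.PerfectStepBloch.kFibΔLim` AT BASE `Lc^m`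
# (claim table `HOME/b2b-balaban-beta-d1-p3/LEAVES-FP.md` sub-row N0b-K-1, unit `b2b-balaban-gan24-p3-g13` = row G-an2-4 ∕ (CONV-C) owner lineage)

NOT IN PRINT; OUR PROOF (bookkeeping over tree theorems BY NAME).  HONEST FRAMING (cell contract, verbatim): «discharging `BetaPertH` makes Bałaban's UV
stability UNCONDITIONAL — a real constructive-QFT result; it is NOT the continuum limit and NOT the Clay problem.»  HONEST DEPENDENCY (verbatim): «continuum
YM on T⁴ ⇐ BetaPertH ∧ nine spine estimates (0/9 proved); BetaPertH ⇐ (D1) ∧ (D4) ∧ CAP+tail; G-an2-4 gates asym, D1 and NE2/3/4.»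

WHAT.  leaf-06's `FP.PerfectRebase` proved that the base-`Lc^m` step family IS the subsequence `j ↦ m·j` of the base-`Lc` (j, m)-family (`KStepUnit_pow_base`), that this
subsequence converges UNCONDITIONALLY to `KPerf (Lc^m) (sfStep (Lc^m)) (smStep 3 (Lc^m)) 1` (`tendsto_jm_subseq_KPerf_pow_base_holds`), and that under X1m-K
`KPerf Lc … m = KPerf (Lc^m) … 1` (`KPerf_eq_KPerf_pow_base_holds_of_exists_tendsto`).  gan24-p3's `GAN24.PerfectStepBloch.KPerf_one_eq_bloch` gives the perfect ONE-step
resolvent at ANY base `≥ 2` in BLOCH FORM.  Composing the two at base `Lc^m` (`2 ≤ Lc`, `1 ≤ m` ⟹ `2 ≤ Lc^m`, `PerfectRebase.two_le_pow`):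
* §1 **`tendsto_jm_subseq_bloch`** (UNCONDITIONAL, `d = 3`, `2 ≤ Lc`, `1 ≤ m`): entry by entry,
  `unitK (sfStep Lc (m·j)) (smStep 3 Lc (m·j)) (KTot (Lc^(m·j+m)) (Lc^(m·j))) x′ y′ a b → [LegOn (Lc^m) a x′ ∧ LegOn (Lc^m) b y′] ·
   Re latticeKernel (kFibΔLim (Lc^m) a (repZ (proj (Lc^m) x′)) b (repZ (proj (Lc^m) y′))) (quo (Lc^m) x′ − quo (Lc^m) y′)`;
  **`KPerf_pow_base_one_eq_bloch`**: the same Bloch form for `KPerf (Lc^m) (sfStep (Lc^m)) (smStep 3 (Lc^m)) 1`.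
* §2 **`KPerf_eq_bloch_of_exists_tendsto`** (under X1m-K = `hconv`, the entrywise convergence of the (j, m)-family — the hypothesis shape of
  `FP.StationarityK.dec_KPerf_succ` ∕ `FP.SymmetryK` ∕ `FP.PerfectRebase`): `KPerf Lc (sfStep Lc) (smStep 3 Lc) m x′ y′ a b =` the Bloch form above — i.e. leaf N0b-K for
  EVERY `m` and ALL quarters in NAMED-limit form is EXACTLY X1m-K away; `KPerf_eq_bloch_of_exists_tendsto_inl_inl` (field–field block).
HONEST: no alias CLOSED form of `kFibΔLim`; X1m-K (the (j, m)-family's convergence off the subsequence `mℕ`) is NOT proved here — it stays the located open input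
of road FP (rows X1m-der ∕ X1m-K); 0 wall binders instantiated; NOT «N0b-K closed», NEVER «G-an2-4 closed», NOT BetaPertH, NOT continuum, NOT Clay.

ABSOLUTE RULE (cell, verbatim): «No internally-minted statement may enter as a cited fact. Every hypothesis is either kernel-proved in this package or a
verbatim quotation of a PUBLISHED theorem with page reference.»  Nothing is cited; no `def`; every input is a tree theorem imported BY NAME.
-/

namespace Summit.QuantumFields.BalabanUV.Beta.FP.PerfectSymbolKBloch

open Filter Topology
open Literature.Probability.LatticeModels (Torus.proj)
open Literature.MathematicalPhysics.QuantumFieldTheory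
open Literature.MathematicalPhysics.QuantumFieldTheory.Balaban1983to89
open Literature.MathematicalPhysics.QuantumFieldTheory.Balaban1983to89.Beta
open B4ContourShift (latticeKernel)
open LatticeForm (quo repZ)
open OneStepResolventKernel (Fib)
open Summit.QuantumFields.BalabanUV.Beta.HessKerDressedUnits (unitK)
open Summit.QuantumFields.BalabanUV.Beta.GAN24.CombesThomas (sfStep smStep)
open Summit.QuantumFields.BalabanUV.Beta.GAN24.CombesThomasFibre (LegOn)
open Summit.QuantumFields.BalabanUV.Beta.GAN24.PerfectStepBloch (kFibΔLim KPerf_one_eq_bloch)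
open Summit.QuantumFields.BalabanUV.Beta.FP.PerfectObjects (KTot)
open Summit.QuantumFields.BalabanUV.Beta.FP.PerfectObjectsT (KPerf)
open Summit.QuantumFields.BalabanUV.Beta.FP.PerfectRebase (two_le_pow tendsto_jm_subseq_KPerf_pow_base_holds
  KPerf_eq_KPerf_pow_base_holds_of_exists_tendsto)

noncomputable section

variable {Lc : ℕ} [NeZero Lc] {m : ℕ}

/-! ## §1 Unconditional: the perfect one-step resolvent at base `Lc^m` and the (j, m)-family along `j ∈ mℕ`, in Bloch form -/

/-- [our object] **THE PERFECT ONE-STEP RESOLVENT AT BASE `Lc^m` IN BLOCH FORM** (`d = 3`, `2 ≤ Lc`, `1 ≤ m`; `GAN24.PerfectStepBloch.KPerf_one_eq_bloch` at base `Lc^m`). -/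
theorem KPerf_pow_base_one_eq_bloch (hLc : 2 ≤ Lc) (hm : 1 ≤ m) (x' y' : Fin (3 + 1) → ℤ) (a b : Fib 3) :
    KPerf (d := 3) (Lc ^ m) (sfStep (Lc ^ m)) (smStep 3 (Lc ^ m)) 1 x' y' a b =
      if LegOn (Lc ^ m) a x' ∧ LegOn (Lc ^ m) b y' then
        (latticeKernel (kFibΔLim (Lc ^ m) a (repZ (Torus.proj (Lc ^ m) x')) b (repZ (Torus.proj (Lc ^ m) y')))
          (quo (Lc ^ m) x' - quo (Lc ^ m) y')).re
      else 0 :=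
  KPerf_one_eq_bloch (Lc := Lc ^ m) (two_le_pow hLc hm) x' y' a b

/-- **THE (j, m)-FAMILY ALONG `j ∈ mℕ` CONVERGES TO THE BLOCH KERNEL AT BASE `Lc^m` — UNCONDITIONAL** (`d = 3`, `2 ≤ Lc`, `1 ≤ m`; entry by entry):
`unitK (sfStep Lc (m·j)) (smStep 3 Lc (m·j)) (KTot (Lc^(m·j+m)) (Lc^(m·j))) x′ y′ a b → [LegOn (Lc^m) a x′ ∧ LegOn (Lc^m) b y′] ·
Re latticeKernel (kFibΔLim (Lc^m) a (repZ (proj x′)) b (repZ (proj y′))) (quo (Lc^m) x′ − quo (Lc^m) y′)` — `PerfectRebase.tendsto_jm_subseq_KPerf_pow_base_holds` read through §1. [our object] -/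
theorem tendsto_jm_subseq_bloch (hLc : 2 ≤ Lc) (hm : 1 ≤ m) (x' y' : Fin (3 + 1) → ℤ) (a b : Fib 3) :
    Tendsto (fun j => unitK (sfStep Lc (m * j)) (smStep 3 Lc (m * j)) (KTot (d := 3) (Lc ^ (m * j + m)) (Lc ^ (m * j))) x' y' a b) atTop
      (𝓝 (if LegOn (Lc ^ m) a x' ∧ LegOn (Lc ^ m) b y' then
        (latticeKernel (kFibΔLim (Lc ^ m) a (repZ (Torus.proj (Lc ^ m) x')) b (repZ (Torus.proj (Lc ^ m) y')))
          (quo (Lc ^ m) x' - quo (Lc ^ m) y')).re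
        else 0)) := by
  rw [← KPerf_pow_base_one_eq_bloch hLc hm x' y' a b]
  exact tendsto_jm_subseq_KPerf_pow_base_holds hLc hm x' y' a b

/-! ## §2 Under X1m-K: the perfect `m`-fold resolvent in Bloch form — leaf N0b-K for every `m`, all quarters, named-limit form -/

/-- **LEAF N0b-K FOR EVERY `m`, ALL FOUR QUARTERS, REDUCED TO X1m-K** (`d = 3`, `2 ≤ Lc`, `1 ≤ m`): if the unit-rescaled (j, m)-family converges entrywise
(`hconv` = X1m-K, the hypothesis shape of `FP.StationarityK.dec_KPerf_succ` ∕ `FP.PerfectRebase`), then for every leg pair and base points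
`KPerf Lc (sfStep Lc) (smStep 3 Lc) m x′ y′ a b = [LegOn (Lc^m) a x′ ∧ LegOn (Lc^m) b y′] · Re latticeKernel (kFibΔLim (Lc^m) a (repZ (proj (Lc^m) x′)) b (repZ (proj (Lc^m) y′))) (quo (Lc^m) x′ − quo (Lc^m) y′)`
— the perfect `m`-fold resolvent is a Bloch kernel on the `Lc^m`-blocks whose multiplier is the uniform real-zone limit of road P1's explicit fibre functions AT BASE `Lc^m`.
`PerfectRebase.KPerf_eq_KPerf_pow_base_holds_of_exists_tendsto` + §1. [our object] -/
theorem KPerf_eq_bloch_of_exists_tendsto (hLc : 2 ≤ Lc) (hm : 1 ≤ m)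
    (hconv : ∀ x y a b, ∃ L : ℝ,
      Tendsto (fun j => unitK (sfStep Lc j) (smStep 3 Lc j) (KTot (d := 3) (Lc ^ (j + m)) (Lc ^ j)) x y a b) atTop (𝓝 L))
    (x' y' : Fin (3 + 1) → ℤ) (a b : Fib 3) :
    KPerf (d := 3) Lc (sfStep Lc) (smStep 3 Lc) m x' y' a b =
      if LegOn (Lc ^ m) a x' ∧ LegOn (Lc ^ m) b y' then
        (latticeKernel (kFibΔLim (Lc ^ m) a (repZ (Torus.proj (Lc ^ m) x')) b (repZ (Torus.proj (Lc ^ m) y')))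
          (quo (Lc ^ m) x' - quo (Lc ^ m) y')).re
      else 0 := by
  rw [KPerf_eq_KPerf_pow_base_holds_of_exists_tendsto hm hconv]
  exact KPerf_pow_base_one_eq_bloch hLc hm x' y' a b

/-- [our object] Field–field quarter under X1m-K (field legs are everywhere on). -/
theorem KPerf_eq_bloch_of_exists_tendsto_inl_inl (hLc : 2 ≤ Lc) (hm : 1 ≤ m)
    (hconv : ∀ x y a b, ∃ L : ℝ,
      Tendsto (fun j => unitK (sfStep Lc j) (smStep 3 Lc j) (KTot (d := 3) (Lc ^ (j + m)) (Lc ^ j)) x y a b) atTop (𝓝 L))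
    (x' y' : Fin (3 + 1) → ℤ) (κ l : Fin (3 + 1)) :
    KPerf (d := 3) Lc (sfStep Lc) (smStep 3 Lc) m x' y' (Sum.inl κ) (Sum.inl l) =
      (latticeKernel (kFibΔLim (Lc ^ m) (Sum.inl κ) (repZ (Torus.proj (Lc ^ m) x')) (Sum.inl l) (repZ (Torus.proj (Lc ^ m) y')))
        (quo (Lc ^ m) x' - quo (Lc ^ m) y')).re := by
  rw [KPerf_eq_bloch_of_exists_tendsto hLc hm hconv, if_pos ⟨trivial, trivial⟩]

/-- [our object] The X1m-K hypothesis is REDUNDANT along the subsequence: with or without it, the `m·j`-th members converge to the right-hand side of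
`KPerf_eq_bloch_of_exists_tendsto` (§1) — so X1m-K is exactly the statement that the FULL (j, m)-family has the limit its subsequence `mℕ` already has. -/
theorem tendsto_jm_subseq_KPerf_of_exists_tendsto (hLc : 2 ≤ Lc) (hm : 1 ≤ m)
    (hconv : ∀ x y a b, ∃ L : ℝ,
      Tendsto (fun j => unitK (sfStep Lc j) (smStep 3 Lc j) (KTot (d := 3) (Lc ^ (j + m)) (Lc ^ j)) x y a b) atTop (𝓝 L))
    (x' y' : Fin (3 + 1) → ℤ) (a b : Fib 3) :
    Tendsto (fun j => unitK (sfStep Lc (m * j)) (smStep 3 Lc (m * j)) (KTot (d := 3) (Lc ^ (m * j + m)) (Lc ^ (m * j))) x' y' a b) atTop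
      (𝓝 (KPerf (d := 3) Lc (sfStep Lc) (smStep 3 Lc) m x' y' a b)) := by
  rw [KPerf_eq_bloch_of_exists_tendsto hLc hm hconv x' y' a b]
  exact tendsto_jm_subseq_bloch hLc hm x' y' a b

end

end Summit.QuantumFields.BalabanUV.Beta.FP.PerfectSymbolKBloch
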